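import Mathlib
import HarnessLib
import Literature.Computability.LeeEtAl2017.PoisonSemantics

/-!
# LLVM Language Reference Manual, release 18.1.3: §'Integer Type' — every bit width from 1 to 2^23 is an integer type

Source followed verbatim: *LLVM Language Reference Manual*, release 18.1.3 [LLVMLangRef18] — `docs/LangRef.rst` at tag `llvmorg-18.1.3`
(pinned copy `inputs/llvm-18.1.3.src/docs/LangRef.rst` of the CertifiedToolchain cell), §'Integer Type' (L3755–3779).  Companion of
`IntegerIntrinsics` / `BinaryOperators` / `BitManipulationIntrinsics` / `UndefinedValues` / `VectorOperations`.

Printed (L3759–3762): "The integer type is a very simple type that simply specifies an arbitrary bit width for the integer type desired.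
Any bit width from 1 bit to 2\ :sup:`23`\ (about 8 million) can be specified."  (L3764–3771): "iN […] The number of bits the integer will
occupy is specified by the ``N`` value."  Examples (L3775–3779): "``i1`` a single-bit integer. | ``i32`` a 32-bit integer. | ``i1942652`` a
really big integer of over 1 million bits."

## What is formalised
The set of legal widths `N` of `iN` as a decidable predicate (`IsIntegerWidth N ↔ 1 ≤ N ≤ 2^23`), the three printed examples, and the
remark the CertifiedToolchain width reports rely on: the NON-power-of-two widths (i3, i5, i6, i7, i24, …) are integer types like any other,
so an InstCombine fold stated for `iN` is stated for them too; the value domain of `iN` in the companion files is `LeeEtAl2017.IVal N`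
for every such `N`.  Nothing here is a claim about what LLVM's optimiser or any target does with unusual widths.
-/

namespace Literature.Computability.LLVMLangRef18

namespace IntegerType

/-- "Any bit width from 1 bit to 2^23 (about 8 million) can be specified": `iN` is an integer type exactly for `1 ≤ N ≤ 2^23`.
[cite: LLVMLangRef18, §'Integer Type' L3759–3762] -/
def IsIntegerWidth (N : ℕ) : Prop := 1 ≤ N ∧ N ≤ 2 ^ 23

/-- The width condition is decidable arithmetic. [cite: LLVMLangRef18, §'Integer Type' L3759–3762] -/
instance instDecidableIsIntegerWidth (N : ℕ) : Decidable (IsIntegerWidth N) := inferInstanceAs (Decidable (1 ≤ N ∧ N ≤ 2 ^ 23))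

/-- `2^23 = 8388608` ("about 8 million"). [cite: LLVMLangRef18, §'Integer Type' L3760–3762] -/
theorem isIntegerWidth_iff (N : ℕ) : IsIntegerWidth N ↔ 1 ≤ N ∧ N ≤ 8388608 := by
  unfold IsIntegerWidth; norm_num

/-- The three printed examples: `i1`, `i32`, `i1942652` ("a really big integer of over 1 million bits"); and `i0` is not a type.
[cite: LLVMLangRef18, §'Integer Type' L3775–3779] -/
theorem printed_examples : IsIntegerWidth 1 ∧ IsIntegerWidth 32 ∧ IsIntegerWidth 1942652 ∧ 1000000 < 1942652 ∧ ¬ IsIntegerWidth 0 := by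
  refine ⟨?_, ?_, ?_, by norm_num, ?_⟩ <;> simp [isIntegerWidth_iff]

/-- The upper end: `i8388608` is a type, `i8388609` is not. [cite: LLVMLangRef18, §'Integer Type' L3760–3762] -/
theorem width_bound : IsIntegerWidth (2 ^ 23) ∧ ¬ IsIntegerWidth (2 ^ 23 + 1) := by
  constructor <;> simp [isIntegerWidth_iff]

/-- **Non-power-of-two widths are integer types** ("arbitrary bit width"): the widths at which the CertifiedToolchain width reports read the
pinned folds (i2, i3, i5, i6, i7, i24) and the usual i8 / i16 / i64 / i128 all satisfy the condition. [cite: LLVMLangRef18, §'Integer Type' L3759–3762] -/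
theorem nonPowerOfTwo_widths : IsIntegerWidth 2 ∧ IsIntegerWidth 3 ∧ IsIntegerWidth 5 ∧ IsIntegerWidth 6 ∧ IsIntegerWidth 7 ∧ IsIntegerWidth 24 ∧
    IsIntegerWidth 8 ∧ IsIntegerWidth 16 ∧ IsIntegerWidth 64 ∧ IsIntegerWidth 128 := by
  simp [isIntegerWidth_iff]

/-- Every width `1 ≤ N ≤ 128` (the range the cell's kernel width tables enumerate) is an integer type. [cite: LLVMLangRef18, §'Integer Type' L3759–3762] -/
theorem isIntegerWidth_of_le_128 {N : ℕ} (h1 : 1 ≤ N) (h2 : N ≤ 128) : IsIntegerWidth N :=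
  ⟨h1, le_trans h2 (by norm_num)⟩

/-- The value domain of `iN` in the companion files: poison or an `N`-bit pattern (`LeeEtAl2017.IVal N = Option (BitVec N)`), available at
every width, in particular at every legal one. [cite: LLVMLangRef18, §'Integer Type' L3764–3771] -/
abbrev Dom (N : ℕ) : Type := LeeEtAl2017.IVal N

end IntegerType

end Literature.Computability.LLVMLangRef18
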